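import Literature.AlgebraicGeometry.Deligne1982.WeilTypeCMHodgeRing
import Literature.AlgebraicGeometry.HodgeTheory.WeilClassesMoonenZarhinCriterionHolds
import Literature.AlgebraicGeometry.HodgeTheory.WeilClassesFieldGeneratorChange
import Mathlib.FieldTheory.Minpoly.IsIntegrallyClosed
import Mathlib.FieldTheory.IsAlgClosed.Basic
import Mathlib.RingTheory.AdjoinRoot
import Mathlib.RingTheory.Localization.Integral
import Mathlib.Algebra.Polynomial.Expand
import HarnessLib

/-!
# Every CM field acting on an abelian variety admits Deligne's presentation `E = ℚ(η)`, `η̄ = -η`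

Layer `Literature/AlgebraicGeometry/Deligne1982`, theorem-only companion of `WeilTypeCMHodgeRing`
(`IsWeilTypeCM A η R e₀ k`: Deligne's carriers for an abelian variety of Weil type relative to a CM
field `E = ℚ(η) ≅ ℚ[T]/(R(T²))`, `η̄ = -η`) and of `HodgeTheory.WeilClassesFieldGeneratorChange`.
Deligne (notes by Milne), *Hodge cycles on abelian varieties*, LNM 900, §4, p. 30, presents a CM field
as "`E = F(η)`, `F` totally real, `η² ∈ F` totally negative, `η̄ = -η`"; the module docstring of
`IsWeilTypeCM` records the claim "every pair `(A, ν : E → End⁰(A))` of Weil type with `E` a CM field is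
of this form for a suitable `η ∈ ν(E) ∩ End(A)`". THIS file proves that claim on the tree's carriers,
starting from the presentation used by the B2b rung R3 (`WeilTypeLadder.WeilClassesCMField`: ONE
endomorphism `φ` with `P(φ) = 0`, `P ∈ ℤ[T]` monic irreducible over `ℚ`, the CM property rendered on
the complex roots of `P` — no real root, one `Q ∈ ℚ[T]` with `Q(ρ) = ρ̄` at every root):

* `exists_int_conjPolynomial`, `exists_nat_candidate_injOn`: denominators of `Q` cleared
  (`Q₁ = N·Q ∈ ℤ[T]`), the candidates `S_t = (N·T - Q₁)(N·T + Q₁ + t) ∈ ℤ[T]` take the purely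
  imaginary values `N(ρ - ρ̄)(N(ρ + ρ̄) + t)` at the roots, and for some `t ∈ ℕ` these values are
  non-zero and pairwise distinct (each coincidence is a non-trivial affine condition on `t`) — so
  `η = S_t(φ)` GENERATES `K = ℚ(φ)` and `η̄ = -η`;
* `exists_even_minpoly`: the minimal polynomial `M ∈ ℤ[T]` of `S(θ)` in `K = ℚ[T]/(P)` (`θ = T mod P`;
  `minpoly ℤ = minpoly ℚ` for integral elements, Mathlib `minpoly.isIntegrallyClosed_eq_field_fractions'`)
  has degree `e = [K:ℚ]` (its complex roots are the `e` distinct numbers `S(ρ)`, images of `S(θ)`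
  under the embeddings `K → ℂ`, Mathlib `Algebra.IsAlgebraic.range_eval_eq_rootSet_minpoly`), satisfies
  `M ∣ M(-T)` (`-S(ρ₀) = S(ρ̄₀)` is again a root) hence `M(-T) = ±M(T)`, the sign being `+` because
  `M(0) ≠ 0`; so `M = R(T²)` (`R = contract 2 M`), `R` monic of degree `e₀ = e/2`, `R(T²)` irreducible
  over `ℚ`, the roots of `R` are the real negative numbers `S(ρ)²`, and `P ∣ M(S(T))` in `ℤ[T]`
  (`M(S(θ)) = 0` in `K`, `P` monic);
* `exists_isWeilTypeCM_of_cmField`: for `(A, φ, P)` as in R3 with balanced multiplicities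
  (`n_ρ = n_ρ̄`, Weil type) and `m ≥ 1`, the endomorphism `η = S(φ)` with this `R` satisfies
  **`IsWeilTypeCM A η R e₀ m`**, and (by `WeilClassesFieldGeneratorChange`) the multiplicities and the
  Weil spaces agree: `eigenMultiplicity A η (S ρ) = eigenMultiplicity A φ ρ`,
  `weilClassesField A η R(T²) r = weilClassesField A φ P r` for every `r`;
* `weilClassesField_cmField_mem_algebraicClasses_of_weilTypeCM`: **rung R3 on Deligne's carriers
  implies rung R3** — the body of `Ring2.Hypotheses.WeilClassesWeilTypeCM` (R3⁺, `e₀ ≥ 2`) implies the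
  body of `WeilTypeLadder.WeilClassesCMField` (R3, `e > 2`): degree `0` is trivial
  (`algebraicClasses_zero`), off Weil type the class is `0` by the Moonen–Zarhin Criterion (ii), a
  THEOREM in the tree (`MoonenZarhin1998_weilClasses_hodgeCriterion_holds`), on Weil type the class is
  moved to Deligne's carriers. Together with the tree's `weilClassesWeilTypeCM_of_weilClassesCMField`
  this makes R3⁺ ⟺ R3 (RING2-MAP §hypotheses gen 7, row R3⁺: "the converse R3⁺ ⟹ R3 needs a change of
  generator … NOT in the tree").

Everything is proved; no definition, no named fact (D-0026). `HC_CM` does not occur.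

## References

* [Deligne1982HodgeCycles] P. Deligne (notes by J. S. Milne), *Hodge cycles on abelian varieties*, in
  LNM 900 (1982), §4: (4.4), Prop. 4.4, and p. 30 ("`E = F(η)` … `η̄ = -η`").
* [MoonenZarhin1998WeilClasses] B. J. J. Moonen, Yu. G. Zarhin, *Weil classes on abelian varieties*,
  J. reine angew. Math. 496 (1998) 83–92 = arXiv:alg-geom/9612017, §1 (`W_F`, `n_σ`, Criterion).
* [LangeBirkenhake1992] H. Lange, Ch. Birkenhake, *Complex Abelian Varieties* (1992), §1.1.
-/

noncomputable section

open CategoryTheory Polynomial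

namespace Literature.AlgebraicGeometry.Deligne1982

open Literature.AlgebraicTopology.SingularHomology
open Literature.AlgebraicGeometry.HodgeTheory
open Literature.AlgebraicGeometry.Motives

section Arithmetic

/-- Complex conjugation commutes with evaluation of an INTEGER polynomial:
`S(ρ̄) = conj (S(ρ))`. [folklore] -/
theorem eval₂_conj_int (S : Polynomial ℤ) (ρ : ℂ) :
    Polynomial.eval₂ (Int.castRingHom ℂ) (starRingEnd ℂ ρ) S =
      starRingEnd ℂ (Polynomial.eval₂ (Int.castRingHom ℂ) ρ S) := by
  rw [Polynomial.hom_eval₂, RingHom.ext_int ((starRingEnd ℂ).comp (Int.castRingHom ℂ)) (Int.castRingHom ℂ)]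

/-- The conjugate of a complex root of an integer polynomial is a root. [folklore] -/
theorem eval₂_conj_eq_zero_of_eval₂_eq_zero {P : Polynomial ℤ} {ρ : ℂ}
    (hρ : Polynomial.eval₂ (Int.castRingHom ℂ) ρ P = 0) :
    Polynomial.eval₂ (Int.castRingHom ℂ) (starRingEnd ℂ ρ) P = 0 := by
  rw [eval₂_conj_int, hρ, map_zero]

/-- **A rational polynomial inducing complex conjugation on the roots, with denominators
cleared**: from `Q ∈ ℚ[T]` with `Q(ρ) = ρ̄` at every complex root `ρ` of `P` (the CM-field binder of
rung R3) one gets `Q₁ ∈ ℤ[T]` and an integer `N ≠ 0` with `Q₁(ρ) = N ρ̄` at every root.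
[cite: Deligne1982HodgeCycles, §4 p. 30 (E = F(η), complex conjugation of a CM field)] -/
theorem exists_int_conjPolynomial {P : Polynomial ℤ} {Q : Polynomial ℚ}
    (hQ : ∀ ρ : ℂ, Polynomial.eval₂ (Int.castRingHom ℂ) ρ P = 0 →
      Polynomial.eval₂ (algebraMap ℚ ℂ) ρ Q = starRingEnd ℂ ρ) :
    ∃ (Q₁ : Polynomial ℤ) (N : ℤ), N ≠ 0 ∧ ∀ ρ : ℂ, Polynomial.eval₂ (Int.castRingHom ℂ) ρ P = 0 →
      Polynomial.eval₂ (Int.castRingHom ℂ) ρ Q₁ = (N : ℂ) * starRingEnd ℂ ρ := by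
  obtain ⟨b, hbM, hb⟩ := IsLocalization.integerNormalization_spec (nonZeroDivisors ℤ) Q
  refine ⟨IsLocalization.integerNormalization (nonZeroDivisors ℤ) Q, b,
    nonZeroDivisors.ne_zero hbM, fun ρ hρ => ?_⟩
  have hmap : (IsLocalization.integerNormalization (nonZeroDivisors ℤ) Q).map (algebraMap ℤ ℚ) =
      Polynomial.C (b : ℚ) * Q := by
    rw [hb]
    ext n
    rw [Polynomial.coeff_smul, Polynomial.coeff_C_mul, zsmul_eq_mul]
  have h := congrArg (Polynomial.eval₂ (algebraMap ℚ ℂ) ρ) hmap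
  rw [Polynomial.eval₂_map, Polynomial.eval₂_mul, Polynomial.eval₂_C, hQ ρ hρ] at h
  rw [RingHom.ext_int ((algebraMap ℚ ℂ).comp (algebraMap ℤ ℚ)) (Int.castRingHom ℂ)] at h
  rw [h, eq_ratCast, Rat.cast_intCast]

/-- **The value of the candidate generator `S_t = (N·T - Q₁)(N·T + Q₁ + t)` at a root**:
`S_t(ρ) = N(ρ - ρ̄) · (N(ρ + ρ̄) + t)`. [folklore] -/
theorem eval₂_candidate {P Q₁ : Polynomial ℤ} {N : ℤ}
    (hQ₁ : ∀ ρ : ℂ, Polynomial.eval₂ (Int.castRingHom ℂ) ρ P = 0 →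
      Polynomial.eval₂ (Int.castRingHom ℂ) ρ Q₁ = (N : ℂ) * starRingEnd ℂ ρ)
    (t : ℕ) {ρ : ℂ} (hρ : Polynomial.eval₂ (Int.castRingHom ℂ) ρ P = 0) :
    Polynomial.eval₂ (Int.castRingHom ℂ) ρ
        ((Polynomial.C N * X - Q₁) * (Polynomial.C N * X + Q₁ + Polynomial.C (t : ℤ))) =
      ((N : ℂ) * ρ - (N : ℂ) * starRingEnd ℂ ρ) *
        ((N : ℂ) * ρ + (N : ℂ) * starRingEnd ℂ ρ + (t : ℂ)) := by
  simp only [Polynomial.eval₂_mul, Polynomial.eval₂_sub, Polynomial.eval₂_add, Polynomial.eval₂_C,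
    Polynomial.eval₂_X, hQ₁ ρ hρ]
  simp only [eq_intCast, Int.cast_natCast]

/-- The value `N(ρ - ρ̄)(N(ρ + ρ̄) + t)` is PURELY IMAGINARY: its conjugate is its negative.
[folklore] -/
theorem conj_candidateValue (N : ℤ) (t : ℕ) (ρ : ℂ) :
    starRingEnd ℂ (((N : ℂ) * ρ - (N : ℂ) * starRingEnd ℂ ρ) *
        ((N : ℂ) * ρ + (N : ℂ) * starRingEnd ℂ ρ + (t : ℂ))) =
      -(((N : ℂ) * ρ - (N : ℂ) * starRingEnd ℂ ρ) *
        ((N : ℂ) * ρ + (N : ℂ) * starRingEnd ℂ ρ + (t : ℂ))) := by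
  simp only [map_mul, map_sub, map_add, map_intCast, map_natCast, Complex.conj_conj]
  ring

/-- **A good parameter `t` exists**: for a finite set `Z` of NON-REAL complex numbers and an
integer `N ≠ 0` there is `t ∈ ℕ` such that the numbers `N(ρ - ρ̄)(N(ρ + ρ̄) + t)`, `ρ ∈ Z`, are
non-zero and pairwise distinct (each of the finitely many coincidences is a non-trivial polynomial
condition on `t`). [folklore] -/
theorem exists_nat_candidate_injOn (Z : Finset ℂ) (hZ : ∀ ρ ∈ Z, starRingEnd ℂ ρ ≠ ρ) {N : ℤ}
    (hN : N ≠ 0) :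
    ∃ t : ℕ, (∀ ρ ∈ Z, ((N : ℂ) * ρ - (N : ℂ) * starRingEnd ℂ ρ) *
        ((N : ℂ) * ρ + (N : ℂ) * starRingEnd ℂ ρ + (t : ℂ)) ≠ 0) ∧
      ∀ ρ ∈ Z, ∀ ρ' ∈ Z,
        ((N : ℂ) * ρ - (N : ℂ) * starRingEnd ℂ ρ) * ((N : ℂ) * ρ + (N : ℂ) * starRingEnd ℂ ρ + (t : ℂ)) =
          ((N : ℂ) * ρ' - (N : ℂ) * starRingEnd ℂ ρ') *
            ((N : ℂ) * ρ' + (N : ℂ) * starRingEnd ℂ ρ' + (t : ℂ)) → ρ = ρ' := by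
  classical
  -- the affine polynomials `s_ρ(t) = N(ρ - ρ̄) · (N(ρ + ρ̄) + t)`
  let s : ℂ → ℂ[X] := fun ρ =>
    Polynomial.C ((N : ℂ) * ρ - (N : ℂ) * starRingEnd ℂ ρ) *
      (Polynomial.C ((N : ℂ) * ρ + (N : ℂ) * starRingEnd ℂ ρ) + X)
  have hs_eval : ∀ ρ (t : ℕ), (s ρ).eval (t : ℂ) =
      ((N : ℂ) * ρ - (N : ℂ) * starRingEnd ℂ ρ) *
        ((N : ℂ) * ρ + (N : ℂ) * starRingEnd ℂ ρ + (t : ℂ)) := by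
    intro ρ t
    simp only [s, Polynomial.eval_mul, Polynomial.eval_add, Polynomial.eval_C, Polynomial.eval_X]
  have hNC : (N : ℂ) ≠ 0 := Int.cast_ne_zero.2 hN
  have hlead : ∀ ρ ∈ Z, (N : ℂ) * ρ - (N : ℂ) * starRingEnd ℂ ρ ≠ 0 := by
    intro ρ hρ h
    apply hZ ρ hρ
    have h' : (N : ℂ) * (ρ - starRingEnd ℂ ρ) = 0 := by rw [mul_sub, h]
    rcases mul_eq_zero.1 h' with h'' | h''
    · exact absurd h'' hNC
    · exact (sub_eq_zero.1 h'').symm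
  have hcoeff1 : ∀ ρ, (s ρ).coeff 1 = (N : ℂ) * ρ - (N : ℂ) * starRingEnd ℂ ρ := by
    intro ρ
    simp only [s, mul_add, Polynomial.coeff_add, Polynomial.coeff_C_mul, Polynomial.coeff_C,
      Polynomial.coeff_X_one, one_ne_zero, if_false, mul_zero, zero_add, mul_one]
  have hcoeff0 : ∀ ρ, (s ρ).coeff 0 = ((N : ℂ) * ρ - (N : ℂ) * starRingEnd ℂ ρ) *
      ((N : ℂ) * ρ + (N : ℂ) * starRingEnd ℂ ρ) := by
    intro ρ
    simp only [s, mul_add, Polynomial.coeff_add, Polynomial.coeff_C_mul, Polynomial.coeff_C,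
      Polynomial.coeff_X_zero, if_true, mul_zero, add_zero]
  have hs_ne : ∀ ρ ∈ Z, s ρ ≠ 0 := by
    intro ρ hρ h
    have h1 := hcoeff1 ρ
    rw [h, Polynomial.coeff_zero] at h1
    exact hlead ρ hρ h1.symm
  have hdiff_ne : ∀ ρ ∈ Z, ∀ ρ' ∈ Z, ρ ≠ ρ' → s ρ - s ρ' ≠ 0 := by
    intro ρ hρ ρ' hρ' hne h
    have heq : s ρ = s ρ' := sub_eq_zero.1 h
    have h1 : (N : ℂ) * ρ - (N : ℂ) * starRingEnd ℂ ρ = (N : ℂ) * ρ' - (N : ℂ) * starRingEnd ℂ ρ' := by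
      rw [← hcoeff1, ← hcoeff1, heq]
    have h0 := hcoeff0 ρ
    rw [heq, hcoeff0 ρ', ← h1] at h0
    have h2 : (N : ℂ) * ρ' + (N : ℂ) * starRingEnd ℂ ρ' = (N : ℂ) * ρ + (N : ℂ) * starRingEnd ℂ ρ :=
      mul_left_cancel₀ (hlead ρ hρ) h0
    apply hne
    have h3 : (N : ℂ) * (2 * ρ) = (N : ℂ) * (2 * ρ') := by linear_combination h1 - h2
    have h4 := mul_left_cancel₀ hNC h3
    have h5 := mul_left_cancel₀ (two_ne_zero : (2 : ℂ) ≠ 0) h4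
    exact h5
  -- the product of all these non-zero polynomials
  let D : ℂ[X] := (∏ ρ ∈ Z, s ρ) * ∏ p ∈ (Z ×ˢ Z).filter (fun p => p.1 ≠ p.2), (s p.1 - s p.2)
  have hD : D ≠ 0 := by
    refine mul_ne_zero (Finset.prod_ne_zero_iff.2 hs_ne) (Finset.prod_ne_zero_iff.2 ?_)
    intro p hp
    obtain ⟨hp1, hp2⟩ := Finset.mem_filter.1 hp
    obtain ⟨h1, h2⟩ := Finset.mem_product.1 hp1
    exact hdiff_ne p.1 h1 p.2 h2 hp2
  obtain ⟨t, ht⟩ : ∃ t : ℕ, D.eval (t : ℂ) ≠ 0 := by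
    by_contra! hall
    apply hD
    apply Polynomial.eq_zero_of_infinite_isRoot
    refine Set.Infinite.mono ?_ (Set.infinite_range_of_injective Nat.cast_injective)
    rintro _ ⟨x, rfl⟩
    exact hall x
  refine ⟨t, fun ρ hρ => ?_, fun ρ hρ ρ' hρ' h => ?_⟩
  · rw [← hs_eval]
    have h1 : (∏ ρ ∈ Z, s ρ).eval (t : ℂ) ≠ 0 := by
      intro h0; apply ht
      change ((∏ ρ ∈ Z, s ρ) * _).eval (t : ℂ) = 0
      rw [Polynomial.eval_mul, h0, zero_mul]
    rw [Polynomial.eval_prod] at h1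
    exact (Finset.prod_ne_zero_iff.1 h1) ρ hρ
  · by_contra hne
    apply ht
    have hmem : (ρ, ρ') ∈ (Z ×ˢ Z).filter (fun p => p.1 ≠ p.2) :=
      Finset.mem_filter.2 ⟨Finset.mem_product.2 ⟨hρ, hρ'⟩, hne⟩
    change ((∏ ρ ∈ Z, s ρ) * ∏ p ∈ (Z ×ˢ Z).filter (fun p => p.1 ≠ p.2), (s p.1 - s p.2)).eval
      (t : ℂ) = 0
    rw [Polynomial.eval_mul, Polynomial.eval_prod, Polynomial.eval_prod,
      Finset.prod_eq_zero hmem (by rw [Polynomial.eval_sub, hs_eval, hs_eval, h, sub_self]), mul_zero]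

end Arithmetic

/-! ### The even minimal polynomial: `minpoly(S(θ)) = R(T²)` over `K = ℚ[T]/(P)` -/

section EvenMinpoly

/-- Coefficients of `p(-X)`: `[Xⁿ] p(-X) = (-1)ⁿ [Xⁿ] p`. [folklore] -/
theorem coeff_comp_neg_X {R : Type*} [CommRing R] (p : Polynomial R) (n : ℕ) :
    (p.comp (-X)).coeff n = (-1) ^ n * p.coeff n := by
  rw [Polynomial.comp_eq_sum_left, Polynomial.sum_def, Polynomial.finsetSum_coeff]
  have h : ∀ k ∈ p.support, (Polynomial.C (p.coeff k) * (-X : Polynomial R) ^ k).coeff n =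
      if n = k then (-1) ^ n * p.coeff n else 0 := by
    intro k _
    have hC : ((-X : Polynomial R) ^ k) = Polynomial.C ((-1 : R) ^ k) * X ^ k := by
      rw [neg_pow, map_pow, map_neg, map_one]
    rw [hC, ← mul_assoc, ← Polynomial.C_mul, Polynomial.coeff_C_mul_X_pow]
    split_ifs with hnk
    · subst hnk; ring
    · rfl
  rw [Finset.sum_congr rfl h, Finset.sum_ite_eq]
  split_ifs with hn
  · rfl
  · rw [Polynomial.notMem_support_iff.1 hn, mul_zero]

/-- `AdjoinRoot.mk f g` is the evaluation of `g` at the root (a formulation free of the choice of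
`Algebra` instance on `AdjoinRoot f`). [folklore] -/
theorem adjoinRoot_mk_eq_eval₂ {R : Type*} [CommRing R] (f g : Polynomial R) :
    AdjoinRoot.mk f g = g.eval₂ (AdjoinRoot.of f) (AdjoinRoot.root f) := by
  have h : AdjoinRoot.mk f = Polynomial.eval₂RingHom (AdjoinRoot.of f) (AdjoinRoot.root f) :=
    Polynomial.ringHom_ext (fun a => by rw [AdjoinRoot.mk_C, Polynomial.coe_eval₂RingHom,
      Polynomial.eval₂_C]) (by rw [AdjoinRoot.mk_X, Polynomial.coe_eval₂RingHom, Polynomial.eval₂_X])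
  rw [h, Polynomial.coe_eval₂RingHom]

/-- **The minimal polynomial of a totally imaginary generator is even.** Let `P ∈ ℤ[T]` be monic,
irreducible over `ℚ`, of degree `e`, with no real complex root, and let `S ∈ ℤ[T]` be injective on the
complex roots of `P` with purely imaginary values there (`S(ρ)‾ = -S(ρ)`). Then the minimal polynomial
of `S(θ)`, `θ = T mod P` in the field `K = ℚ[T]/(P)`, is `R(T²)` for a monic `R ∈ ℤ[T]` of degree
`e₀ = e/2` (so `e` is even) with `R(T²)` irreducible over `ℚ`, all roots of `R` real and negative,
`P ∣ R(S(T)²)` in `ℤ[T]`, and the complex roots of `R(T²)` are exactly the `S(ρ)`, `P(ρ) = 0` —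
the presentation `E = ℚ(η) = F(η)`, `F = ℚ(η²)` totally real, `η² ∈ F` totally negative, of a CM field
(Deligne LNM 900 p. 30). [cite: Deligne1982HodgeCycles, §4 p. 30] -/
theorem exists_even_minpoly {P S : Polynomial ℤ} {e : ℕ} (hPm : P.Monic) (hPe : P.natDegree = e)
    (hPirr : Irreducible (P.map (Int.castRingHom ℚ)))
    (hinj : ∀ ρ ρ' : ℂ, Polynomial.eval₂ (Int.castRingHom ℂ) ρ P = 0 →
      Polynomial.eval₂ (Int.castRingHom ℂ) ρ' P = 0 →
      Polynomial.eval₂ (Int.castRingHom ℂ) ρ S = Polynomial.eval₂ (Int.castRingHom ℂ) ρ' S → ρ = ρ')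
    (hodd : ∀ ρ : ℂ, Polynomial.eval₂ (Int.castRingHom ℂ) ρ P = 0 →
      starRingEnd ℂ (Polynomial.eval₂ (Int.castRingHom ℂ) ρ S) = -Polynomial.eval₂ (Int.castRingHom ℂ) ρ S)
    (hnr : ∀ ρ : ℂ, Polynomial.eval₂ (Int.castRingHom ℂ) ρ P = 0 → starRingEnd ℂ ρ ≠ ρ) :
    ∃ (R : Polynomial ℤ) (e₀ : ℕ), e = 2 * e₀ ∧ R.Monic ∧ R.natDegree = e₀ ∧
      Irreducible ((R.comp (X ^ 2)).map (Int.castRingHom ℚ)) ∧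
      (∀ s : ℂ, Polynomial.eval₂ (Int.castRingHom ℂ) s R = 0 → s.im = 0 ∧ s.re < 0) ∧
      P ∣ (R.comp (X ^ 2)).comp S ∧
      (∀ μ : ℂ, Polynomial.eval₂ (Int.castRingHom ℂ) μ (R.comp (X ^ 2)) = 0 ↔
        ∃ ρ : ℂ, Polynomial.eval₂ (Int.castRingHom ℂ) ρ P = 0 ∧ μ = Polynomial.eval₂ (Int.castRingHom ℂ) ρ S) := by
  classical
  haveI : Fact (Irreducible (P.map (Int.castRingHom ℚ))) := ⟨hPirr⟩
  haveI : FiniteDimensional ℚ (AdjoinRoot (P.map (Int.castRingHom ℚ))) :=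
    (AdjoinRoot.powerBasis hPirr.ne_zero).finite
  set θ : AdjoinRoot (P.map (Int.castRingHom ℚ)) := AdjoinRoot.root (P.map (Int.castRingHom ℚ)) with hθdef
  have hP0 : P ≠ 0 := hPm.ne_zero
  -- `θ` is an integral root of `P`
  have hθP : Polynomial.aeval θ P = 0 := by
    rw [Polynomial.aeval_def,
      RingHom.ext_int (algebraMap ℤ (AdjoinRoot (P.map (Int.castRingHom ℚ))))
        ((AdjoinRoot.of (P.map (Int.castRingHom ℚ))).comp (Int.castRingHom ℚ)),
      ← Polynomial.eval₂_map, hθdef]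
    exact AdjoinRoot.eval₂_root _
  have hθint : IsIntegral ℤ θ := ⟨P, hPm, by rwa [← Polynomial.aeval_def]⟩
  -- `ηK = S(θ)` and its minimal polynomial `M` over `ℤ` (= over `ℚ`)
  set ηK : AdjoinRoot (P.map (Int.castRingHom ℚ)) := Polynomial.aeval θ S with hηK
  have hηint : IsIntegral ℤ ηK :=
    .of_mem_of_fg _ hθint.fg_adjoin_singleton _ (Polynomial.aeval_mem_adjoin_singleton ℤ θ)
  have hηintQ : IsIntegral ℚ ηK := .of_finite ℚ ηK
  set M : Polynomial ℤ := minpoly ℤ ηK with hM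
  have hMm : M.Monic := minpoly.monic hηint
  have hMq : minpoly ℚ ηK = M.map (Int.castRingHom ℚ) := by
    have h := minpoly.isIntegrallyClosed_eq_field_fractions' ℚ hηint
    rwa [algebraMap_int_eq] at h
  have hMqm : (M.map (Int.castRingHom ℚ)).Monic := hMm.map _
  have hMq_irr : Irreducible (M.map (Int.castRingHom ℚ)) := hMq ▸ minpoly.irreducible hηintQ
  have hMdeg_map : (M.map (Int.castRingHom ℚ)).natDegree = M.natDegree := hMm.natDegree_map _
  -- the embeddings `K → ℂ` and the value of `ηK`
  have hψη : ∀ ψ : AdjoinRoot (P.map (Int.castRingHom ℚ)) →+* ℂ,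
      ψ ηK = Polynomial.eval₂ (Int.castRingHom ℂ) (ψ θ) S := by
    intro ψ
    rw [hηK, Polynomial.aeval_def, Polynomial.hom_eval₂,
      RingHom.ext_int (ψ.comp (algebraMap ℤ (AdjoinRoot (P.map (Int.castRingHom ℚ))))) (Int.castRingHom ℂ)]
  have hliftable : ∀ ρ : ℂ, Polynomial.eval₂ (Int.castRingHom ℂ) ρ P = 0 →
      (P.map (Int.castRingHom ℚ)).eval₂ (algebraMap ℚ ℂ) ρ = 0 := by
    intro ρ hρ
    rw [Polynomial.eval₂_map, RingHom.ext_int ((algebraMap ℚ ℂ).comp (Int.castRingHom ℚ))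
      (Int.castRingHom ℂ), hρ]
  -- (i) every `S(ρ)` is a complex root of `M`
  have hroot1 : ∀ ρ : ℂ, Polynomial.eval₂ (Int.castRingHom ℂ) ρ P = 0 →
      Polynomial.aeval (Polynomial.eval₂ (Int.castRingHom ℂ) ρ S) (M.map (Int.castRingHom ℚ)) = 0 := by
    intro ρ hρ
    let ψ : AdjoinRoot (P.map (Int.castRingHom ℚ)) →+* ℂ :=
      AdjoinRoot.lift (algebraMap ℚ ℂ) ρ (hliftable ρ hρ)
    have hψθ : ψ θ = ρ := AdjoinRoot.lift_root (hliftable ρ hρ)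
    rw [← hMq, ← hψθ, ← hψη ψ]
    exact aeval_ringHom_minpoly_eq_zero ψ ηK
  -- (ii) every complex root of `M` is some `S(ρ)`
  have hroot2 : ∀ z : ℂ, Polynomial.aeval z (M.map (Int.castRingHom ℚ)) = 0 →
      ∃ ρ : ℂ, Polynomial.eval₂ (Int.castRingHom ℂ) ρ P = 0 ∧
        z = Polynomial.eval₂ (Int.castRingHom ℂ) ρ S := by
    intro z hz
    have hz' : z ∈ (minpoly ℚ ηK).rootSet ℂ := by
      rw [hMq]; exact Polynomial.mem_rootSet.2 ⟨hMq_irr.ne_zero, hz⟩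
    rw [← Algebra.IsAlgebraic.range_eval_eq_rootSet_minpoly ℂ ηK] at hz'
    obtain ⟨ψ, hψ⟩ := hz'
    refine ⟨ψ θ, eval₂_ringHom_root_eq_zero P ψ.toRingHom, ?_⟩
    rw [← hψ]
    exact hψη ψ.toRingHom
  -- the same two facts in `eval₂` form
  have hrootM : ∀ μ : ℂ, Polynomial.eval₂ (Int.castRingHom ℂ) μ M = 0 ↔
      ∃ ρ : ℂ, Polynomial.eval₂ (Int.castRingHom ℂ) ρ P = 0 ∧
        μ = Polynomial.eval₂ (Int.castRingHom ℂ) ρ S := by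
    intro μ
    rw [← aeval_map_castRingHom_rat μ M]
    exact ⟨hroot2 μ, fun ⟨ρ, hρ, hμ⟩ => hμ ▸ hroot1 ρ hρ⟩
  -- `S(ρ) ≠ 0` at every root
  have hS0 : ∀ ρ : ℂ, Polynomial.eval₂ (Int.castRingHom ℂ) ρ P = 0 →
      Polynomial.eval₂ (Int.castRingHom ℂ) ρ S ≠ 0 := by
    intro ρ hρ h0
    have hρbar := eval₂_conj_eq_zero_of_eval₂_eq_zero hρ
    have h1 : Polynomial.eval₂ (Int.castRingHom ℂ) (starRingEnd ℂ ρ) S =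
        Polynomial.eval₂ (Int.castRingHom ℂ) ρ S := by
      rw [eval₂_conj_int, h0, map_zero]
    exact hnr ρ hρ (hinj _ _ hρbar hρ h1)
  -- a root `ρ₀` of `P`, its embedding `ψ₀`, and `M(-ηK) = 0`
  obtain ⟨ρ₀, hρ₀⟩ : ∃ ρ₀ : ℂ, Polynomial.eval₂ (Int.castRingHom ℂ) ρ₀ P = 0 := by
    have hdeg : 0 < (P.map (Int.castRingHom ℂ)).degree := by
      rw [Polynomial.degree_map_eq_of_injective (RingHom.injective_int _)]
      have h := Polynomial.degree_pos_of_irreducible hPirr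
      rwa [Polynomial.degree_map_eq_of_injective (RingHom.injective_int _)] at h
    obtain ⟨z, hz⟩ := Complex.exists_root hdeg
    exact ⟨z, by rwa [Polynomial.IsRoot.def, Polynomial.eval_map] at hz⟩
  let ψ₀ : AdjoinRoot (P.map (Int.castRingHom ℚ)) →+* ℂ :=
    AdjoinRoot.lift (algebraMap ℚ ℂ) ρ₀ (hliftable ρ₀ hρ₀)
  have hψ₀θ : ψ₀ θ = ρ₀ := AdjoinRoot.lift_root (hliftable ρ₀ hρ₀)
  have hnegroot : Polynomial.aeval (-ηK) (M.map (Int.castRingHom ℚ)) = 0 := by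
    apply ψ₀.injective
    rw [map_zero, Polynomial.aeval_def, Polynomial.hom_eval₂, map_neg,
      RingHom.ext_rat (ψ₀.comp (algebraMap ℚ _)) (algebraMap ℚ ℂ), hψη ψ₀, hψ₀θ, ← hodd ρ₀ hρ₀,
      ← eval₂_conj_int, ← Polynomial.aeval_def]
    exact hroot1 _ (eval₂_conj_eq_zero_of_eval₂_eq_zero hρ₀)
  -- `M ∣ M(-X)`, hence `M(-X) = (-1)^deg M · M`
  have hdvd : M.map (Int.castRingHom ℚ) ∣ (M.map (Int.castRingHom ℚ)).comp (-X) := by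
    rw [← hMq]
    apply minpoly.dvd
    rw [Polynomial.aeval_comp, map_neg, Polynomial.aeval_X, hMq]
    exact hnegroot
  have hdeg : ((M.map (Int.castRingHom ℚ)).comp (-X)).natDegree ≤ (M.map (Int.castRingHom ℚ)).natDegree := by
    rw [Polynomial.natDegree_comp, Polynomial.natDegree_neg, Polynomial.natDegree_X, mul_one]
  have hcomp := Polynomial.eq_leadingCoeff_mul_of_monic_of_dvd_of_natDegree_le hMqm hdvd hdeg
  rw [Polynomial.comp_neg_X_leadingCoeff_eq, hMqm.leadingCoeff, mul_one] at hcomp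
  have hcoeff : ∀ n, (-1 : ℚ) ^ n * (M.map (Int.castRingHom ℚ)).coeff n =
      (-1) ^ (M.map (Int.castRingHom ℚ)).natDegree * (M.map (Int.castRingHom ℚ)).coeff n := by
    intro n
    have h := congrArg (fun p => Polynomial.coeff p n) hcomp
    simp only [coeff_comp_neg_X, Polynomial.coeff_C_mul] at h
    exact h
  -- `deg M` is even: otherwise `M(0) = 0`, i.e. `0 = S(ρ)` for some root, impossible
  have hdeven : Even (M.map (Int.castRingHom ℚ)).natDegree := by
    rcases Nat.even_or_odd (M.map (Int.castRingHom ℚ)).natDegree with h | h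
    · exact h
    · exfalso
      have h0 := hcoeff 0
      rw [pow_zero, one_mul, h.neg_one_pow, neg_one_mul] at h0
      have hc0 : (M.map (Int.castRingHom ℚ)).coeff 0 = 0 := by linarith
      have hz : Polynomial.aeval (0 : ℂ) (M.map (Int.castRingHom ℚ)) = 0 := by
        rw [Polynomial.aeval_def, Polynomial.eval₂_at_zero, hc0, map_zero]
      obtain ⟨ρ, hρ, h0ρ⟩ := hroot2 0 hz
      exact hS0 ρ hρ h0ρ.symm
  -- odd coefficients vanish
  have hoddQ : ∀ n, Odd n → (M.map (Int.castRingHom ℚ)).coeff n = 0 := by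
    intro n hn
    have h := hcoeff n
    rw [hn.neg_one_pow, hdeven.neg_one_pow, one_mul, neg_one_mul] at h
    linarith
  have hoddZ : ∀ n, Odd n → M.coeff n = 0 := by
    intro n hn
    have h := hoddQ n hn
    rw [Polynomial.coeff_map, eq_intCast, Int.cast_eq_zero] at h
    exact h
  -- `R := Σ [T^{2k}]M · T^k`, `R(T²) = M`
  set R : Polynomial ℤ := Polynomial.contract 2 M with hR
  have hRM : R.comp (X ^ 2) = M := by
    rw [← Polynomial.expand_eq_comp_X_pow]
    ext n
    rw [Polynomial.coeff_expand (by norm_num : 0 < 2)]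
    split_ifs with h2
    · rw [hR, Polynomial.coeff_contract two_ne_zero, Nat.div_mul_cancel h2]
    · exact (hoddZ n (Nat.odd_iff.2 (Nat.two_dvd_ne_zero.1 h2))).symm
  have hRm : R.Monic := by
    have h : (Polynomial.expand ℤ 2 R).Monic := by
      rw [Polynomial.expand_eq_comp_X_pow, hRM]; exact hMm
    exact (Polynomial.monic_expand_iff (by norm_num)).1 h
  -- `deg M = e`: `≤` since `[K:ℚ] = e`, `≥` since the `e` distinct numbers `S(ρ)` are roots
  have hMdeg : M.natDegree = e := by
    apply le_antisymm
    · rw [← hMdeg_map, ← hMq]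
      have h := minpoly.natDegree_le ηK (A := ℚ)
      rw [(AdjoinRoot.powerBasis hPirr.ne_zero).finrank, AdjoinRoot.powerBasis_dim,
        hPm.natDegree_map, hPe] at h
      exact h
    · -- the finite set of complex roots of `P` and its image under `S`
      let Z : Finset ℂ := (P.map (Int.castRingHom ℂ)).roots.toFinset
      have hZ : ∀ μ, μ ∈ Z ↔ Polynomial.eval₂ (Int.castRingHom ℂ) μ P = 0 := mem_roots_toFinset_map_iff hP0
      have hsepC : (P.map (Int.castRingHom ℂ)).Separable := by
        rw [map_castRingHom_complex_eq]; exact hPirr.separable.map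
      have hZcard : Z.card = e := by
        rw [Multiset.toFinset_card_of_nodup (Polynomial.nodup_roots hsepC),
          IsAlgClosed.card_roots_eq_natDegree, hPm.natDegree_map, hPe]
      have hMC0 : M.map (Int.castRingHom ℂ) ≠ 0 :=
        (Polynomial.map_ne_zero_iff (RingHom.injective_int (Int.castRingHom ℂ))).2 hMm.ne_zero
      have hsub : Z.image (fun ρ => Polynomial.eval₂ (Int.castRingHom ℂ) ρ S) ⊆
          (M.map (Int.castRingHom ℂ)).roots.toFinset := by
        intro μ hμ
        obtain ⟨ρ, hρ, rfl⟩ := Finset.mem_image.1 hμ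
        rw [mem_roots_toFinset_map_iff hMm.ne_zero, hrootM]
        exact ⟨ρ, (hZ ρ).1 hρ, rfl⟩
      have hinjZ : Set.InjOn (fun ρ => Polynomial.eval₂ (Int.castRingHom ℂ) ρ S) ↑Z :=
        fun ρ hρ ρ' hρ' h => hinj ρ ρ' ((hZ ρ).1 hρ) ((hZ ρ').1 hρ') h
      calc e = (Z.image (fun ρ => Polynomial.eval₂ (Int.castRingHom ℂ) ρ S)).card := by
              rw [Finset.card_image_of_injOn hinjZ, hZcard]
        _ ≤ (M.map (Int.castRingHom ℂ)).roots.toFinset.card := Finset.card_le_card hsub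
        _ ≤ Multiset.card (M.map (Int.castRingHom ℂ)).roots := Multiset.toFinset_card_le _
        _ ≤ (M.map (Int.castRingHom ℂ)).natDegree := Polynomial.card_roots' _
        _ = M.natDegree := hMm.natDegree_map _
  have he : e = 2 * R.natDegree := by
    rw [← hMdeg, ← hRM, ← Polynomial.expand_eq_comp_X_pow, Polynomial.natDegree_expand, mul_comm]
  refine ⟨R, R.natDegree, he, hRm, rfl, ?_, ?_, ?_, ?_⟩
  · rw [hRM]; exact hMq_irr
  · -- roots of `R` are the squares `S(ρ)²` of purely imaginary non-zero numbers
    intro s hs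
    obtain ⟨z, hz⟩ := IsAlgClosed.exists_eq_mul_self s
    have hzM : Polynomial.eval₂ (Int.castRingHom ℂ) z M = 0 := by
      rw [← hRM, Polynomial.eval₂_comp, Polynomial.eval₂_X_pow, sq, ← hz, hs]
    obtain ⟨ρ, hρ, hzρ⟩ := (hrootM z).1 hzM
    have hconj := hodd ρ hρ
    rw [← hzρ] at hconj
    have hre : z.re = 0 := by
      have h := congrArg Complex.re hconj
      rw [Complex.conj_re, Complex.neg_re] at h
      linarith
    have hz0 : z ≠ 0 := by rw [hzρ]; exact hS0 ρ hρ
    have him : z.im ≠ 0 := by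
      intro h0; apply hz0; exact Complex.ext hre h0
    refine ⟨?_, ?_⟩
    · rw [hz, Complex.mul_im, hre, zero_mul, mul_zero, add_zero]
    · rw [hz, Complex.mul_re, hre, mul_zero, zero_sub, neg_lt_zero]
      exact mul_self_pos.2 him
  · -- `P ∣ M(S(T))` in `ℤ[T]`: `M(S(θ)) = 0` in `K = ℚ[T]/(P)` and `P` is monic
    rw [hRM]
    have h2 : AdjoinRoot.mk (P.map (Int.castRingHom ℚ)) ((M.comp S).map (Int.castRingHom ℚ)) = 0 := by
      rw [adjoinRoot_mk_eq_eval₂, Polynomial.eval₂_map,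
        RingHom.ext_int ((AdjoinRoot.of (P.map (Int.castRingHom ℚ))).comp (Int.castRingHom ℚ))
          (algebraMap ℤ (AdjoinRoot (P.map (Int.castRingHom ℚ)))),
        ← hθdef, ← Polynomial.aeval_def, Polynomial.aeval_comp, ← hηK, hM, minpoly.aeval]
    rw [AdjoinRoot.mk_eq_zero] at h2
    exact (Polynomial.map_dvd_map (Int.castRingHom ℚ) (RingHom.injective_int _) hPm).1 h2
  · intro μ
    rw [hRM]
    exact hrootM μ

end EvenMinpoly

/-! ### Deligne's presentation `E = ℚ(η)`, `η̄ = -η`, of a CM field acting on an abelian variety -/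

section Geometry

variable {A : AbelianVariety ℂ}

/-- **Every CM field acting on an abelian variety with balanced multiplicities admits Deligne's
presentation** (the claim of the module docstring of `IsWeilTypeCM`: "every pair `(A, ν : E → End⁰(A))`
of Weil type with `E` a CM field is of this form for a suitable `η ∈ ν(E) ∩ End(A)`"). Data as in the
rung R3 (`WeilTypeLadder.WeilClassesCMField`): `φ : A ⟶ A` with `P(φ) = 0`, `P ∈ ℤ[T]` monic, irreducible
over `ℚ`, of degree `e > 2`, `e·(2m) = 2 dim A`, `m ≥ 1`, `K = ℚ(φ)` a CM field (no real root; one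
`Q ∈ ℚ[T]` carrying every root to its conjugate), and Weil type (`n_ρ = n_ρ̄` at every root). Then there
are `S, R ∈ ℤ[T]`, `e₀` with `e = 2e₀`, and `η = S(φ) ∈ ℤ[φ] ⊂ End(A)` such that `IsWeilTypeCM A η R e₀ m`
holds (`E = ℚ(η) = K`, `η̄ = -η`, minimal polynomial `R(T²)`), `S` is injective on the complex roots of
`P`, the roots of `R(T²)` are the `S(ρ)`, the multiplicities agree (`n_{S(ρ)}(η) = n_ρ(φ)`), and the
Weil spaces agree in every degree: `weilClassesField A η R(T²) r = weilClassesField A φ P r`.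
[cite: Deligne1982HodgeCycles, §4 (4.4) and p. 30 (E = F(η), η̄ = -η)]
[cite: MoonenZarhin1998WeilClasses, §1 (W_F, n_σ attached to the field F)] -/
theorem exists_isWeilTypeCM_of_cmField {φ : A ⟶ A} {P : Polynomial ℤ} {e m : ℕ}
    (hPm : P.Monic) (hPe : P.natDegree = e) (he2 : 2 < e)
    (hPirr : Irreducible (P.map (Int.castRingHom ℚ)))
    (hφ : Polynomial.eval₂ (Int.castRingHom (CategoryTheory.End A)) (φ : CategoryTheory.End A) P = 0)
    (hdim : e * (2 * m) = 2 * A.dim) (hm : 0 < m)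
    (hnr : ∀ ρ : ℂ, Polynomial.eval₂ (Int.castRingHom ℂ) ρ P = 0 → starRingEnd ℂ ρ ≠ ρ)
    (hQ : ∃ Q : Polynomial ℚ, ∀ ρ : ℂ, Polynomial.eval₂ (Int.castRingHom ℂ) ρ P = 0 →
      Polynomial.eval₂ (algebraMap ℚ ℂ) ρ Q = starRingEnd ℂ ρ)
    (hbal : ∀ ρ : ℂ, Polynomial.eval₂ (Int.castRingHom ℂ) ρ P = 0 →
      eigenMultiplicity A φ ρ = eigenMultiplicity A φ (starRingEnd ℂ ρ)) :
    ∃ (S R : Polynomial ℤ) (e₀ : ℕ) (η : A ⟶ A), e = 2 * e₀ ∧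
      (η : CategoryTheory.End A) =
        Polynomial.eval₂ (Int.castRingHom (CategoryTheory.End A)) (φ : CategoryTheory.End A) S ∧
      IsWeilTypeCM A η R e₀ m ∧
      (∀ ρ ρ' : ℂ, Polynomial.eval₂ (Int.castRingHom ℂ) ρ P = 0 →
        Polynomial.eval₂ (Int.castRingHom ℂ) ρ' P = 0 →
        Polynomial.eval₂ (Int.castRingHom ℂ) ρ S = Polynomial.eval₂ (Int.castRingHom ℂ) ρ' S → ρ = ρ') ∧
      (∀ μ : ℂ, Polynomial.eval₂ (Int.castRingHom ℂ) μ (R.comp (X ^ 2)) = 0 ↔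
        ∃ ρ : ℂ, Polynomial.eval₂ (Int.castRingHom ℂ) ρ P = 0 ∧
          μ = Polynomial.eval₂ (Int.castRingHom ℂ) ρ S) ∧
      (∀ ρ : ℂ, Polynomial.eval₂ (Int.castRingHom ℂ) ρ P = 0 →
        eigenMultiplicity A η (Polynomial.eval₂ (Int.castRingHom ℂ) ρ S) = eigenMultiplicity A φ ρ) ∧
      ∀ r : ℕ, weilClassesField A η (R.comp (X ^ 2)) r = weilClassesField A φ P r := by
  classical
  obtain ⟨Q, hQ⟩ := hQ
  obtain ⟨Q₁, N, hN, hQ₁⟩ := exists_int_conjPolynomial hQ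
  have hP0 : P ≠ 0 := hPm.ne_zero
  let Z : Finset ℂ := (P.map (Int.castRingHom ℂ)).roots.toFinset
  have hZ : ∀ μ, μ ∈ Z ↔ Polynomial.eval₂ (Int.castRingHom ℂ) μ P = 0 := mem_roots_toFinset_map_iff hP0
  obtain ⟨t, _, htinj⟩ := exists_nat_candidate_injOn Z (fun ρ hρ => hnr ρ ((hZ ρ).1 hρ)) hN
  have hSval : ∀ ρ : ℂ, Polynomial.eval₂ (Int.castRingHom ℂ) ρ P = 0 →
      Polynomial.eval₂ (Int.castRingHom ℂ) ρ
        ((Polynomial.C N * X - Q₁) * (Polynomial.C N * X + Q₁ + Polynomial.C (t : ℤ))) =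
      ((N : ℂ) * ρ - (N : ℂ) * starRingEnd ℂ ρ) *
        ((N : ℂ) * ρ + (N : ℂ) * starRingEnd ℂ ρ + (t : ℂ)) :=
    fun ρ hρ => eval₂_candidate hQ₁ t hρ
  have hinj : ∀ ρ ρ' : ℂ, Polynomial.eval₂ (Int.castRingHom ℂ) ρ P = 0 →
      Polynomial.eval₂ (Int.castRingHom ℂ) ρ' P = 0 →
      Polynomial.eval₂ (Int.castRingHom ℂ) ρ
        ((Polynomial.C N * X - Q₁) * (Polynomial.C N * X + Q₁ + Polynomial.C (t : ℤ))) =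
      Polynomial.eval₂ (Int.castRingHom ℂ) ρ'
        ((Polynomial.C N * X - Q₁) * (Polynomial.C N * X + Q₁ + Polynomial.C (t : ℤ))) → ρ = ρ' := by
    intro ρ ρ' hρ hρ' h
    rw [hSval ρ hρ, hSval ρ' hρ'] at h
    exact htinj ρ ((hZ ρ).2 hρ) ρ' ((hZ ρ').2 hρ') h
  have hodd : ∀ ρ : ℂ, Polynomial.eval₂ (Int.castRingHom ℂ) ρ P = 0 →
      starRingEnd ℂ (Polynomial.eval₂ (Int.castRingHom ℂ) ρ
        ((Polynomial.C N * X - Q₁) * (Polynomial.C N * X + Q₁ + Polynomial.C (t : ℤ)))) =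
      -Polynomial.eval₂ (Int.castRingHom ℂ) ρ
        ((Polynomial.C N * X - Q₁) * (Polynomial.C N * X + Q₁ + Polynomial.C (t : ℤ))) := by
    intro ρ hρ
    rw [hSval ρ hρ]
    exact conj_candidateValue N t ρ
  obtain ⟨R, e₀, he, hRm, hRdeg, hRirr, hRroots, hdvd, hiff⟩ :=
    exists_even_minpoly hPm hPe hPirr hinj hodd hnr
  -- `η = S(φ)` and `R(η²) = 0` in `End A`
  let η : A ⟶ A := End.asHom (Polynomial.eval₂ (Int.castRingHom (CategoryTheory.End A)) (End.of φ)
    ((Polynomial.C N * X - Q₁) * (Polynomial.C N * X + Q₁ + Polynomial.C (t : ℤ))))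
  have hη : (η : CategoryTheory.End A) =
      Polynomial.eval₂ (Int.castRingHom (CategoryTheory.End A)) (φ : CategoryTheory.End A)
        ((Polynomial.C N * X - Q₁) * (Polynomial.C N * X + Q₁ + Polynomial.C (t : ℤ))) := rfl
  have hηR : Polynomial.eval₂ (Int.castRingHom (CategoryTheory.End A)) (η : CategoryTheory.End A)
      (R.comp (X ^ 2)) = 0 := by
    obtain ⟨G, hG⟩ := hdvd
    have hamap : Int.castRingHom (CategoryTheory.End A) = algebraMap ℤ (CategoryTheory.End A) :=
      RingHom.ext_int _ _
    rw [hη, hamap, ← Polynomial.eval₂_comp', hG, Polynomial.eval₂_mul', ← hamap, hφ, zero_mul]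
  -- multiplicities
  have h2m : ∀ ρ : ℂ, Polynomial.eval₂ (Int.castRingHom ℂ) ρ P = 0 → eigenMultiplicity A φ ρ = m := by
    intro ρ hρ
    have hsum := eigenMultiplicity_add_eigenMultiplicity_conj_eq hPm hPe hPirr hφ hdim hρ
    have hb := hbal ρ hρ
    omega
  have hmultη : ∀ ρ : ℂ, Polynomial.eval₂ (Int.castRingHom ℂ) ρ P = 0 →
      eigenMultiplicity A η (Polynomial.eval₂ (Int.castRingHom ℂ) ρ
        ((Polynomial.C N * X - Q₁) * (Polynomial.C N * X + Q₁ + Polynomial.C (t : ℤ)))) =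
      eigenMultiplicity A φ ρ :=
    fun ρ hρ => eigenMultiplicity_eq_of_eq_eval₂ hPirr hφ hη hinj hρ
  have hWT : IsWeilTypeCM A η R e₀ m :=
    { e₀_pos := by omega
      k_pos := hm
      monic := hRm
      natDegree_eq := hRdeg
      irreducible := hRirr
      root_real_neg := hRroots
      eval₂_eq_zero := hηR
      dim_eq := by
        subst he
        have h2 : 2 * A.dim = 2 * (2 * m * e₀) := by rw [← hdim]; ring
        omega
      multiplicity_eq := by
        intro μ hμ
        obtain ⟨ρ, hρ, rfl⟩ := (hiff μ).1 hμ
        rw [hmultη ρ hρ, h2m ρ hρ] }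
  refine ⟨_, R, e₀, η, he, hη, hWT, hinj, hiff, hmultη, fun r => ?_⟩
  exact weilClassesField_eq_of_eq_eval₂ hPirr hφ hη hinj (fun μ hμ => (hiff μ).1 hμ)
    (fun ρ hρ => (hiff _).2 ⟨ρ, hρ, rfl⟩) r

/-- **Rung R3 on Deligne's carriers implies rung R3** (the converse of
`Ring2.Hypotheses.weilClassesWeilTypeCM_of_weilClassesCMField`, RING2-MAP §hypotheses gen 7 row R3⁺:
"the converse R3⁺ ⟹ R3 needs a change of generator of `E` on the spectral carrier"). If every rational
`(k,k)` class of `weilClassesField B η R(T²) (2k)` is algebraic for every Weil-type CM datum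
`IsWeilTypeCM B η R e₀ k` with `e₀ ≥ 2` (the body of `Ring2.Hypotheses.WeilClassesWeilTypeCM`), then
for every CM-field datum of rung R3 — `φ : A ⟶ A`, `P(φ) = 0`, `P` monic irreducible of degree `e > 2`,
`e·(2m) = 2 dim A`, no real root, a conjugation polynomial `Q` — every rational `(m,m)` class of
`weilClassesField A φ P (2m)` is algebraic (the body of `WeilTypeLadder.WeilClassesCMField`). Proof:
`m = 0`: everything in degree `0` is algebraic (`algebraicClasses_zero`); off Weil type the class is `0`
by the Moonen–Zarhin Criterion (ii), a THEOREM (`MoonenZarhin1998_weilClasses_hodgeCriterion_holds`); on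
Weil type `exists_isWeilTypeCM_of_cmField` moves the class to Deligne's carriers. Stated on the two
∀-bodies, so no Summit file is imported (D-0026: theorems only).
[cite: Deligne1982HodgeCycles, §4 (4.4), Prop. 4.4 and p. 30] [cite: MoonenZarhin1998WeilClasses, §1 (Criterion)] -/
theorem weilClassesField_cmField_mem_algebraicClasses_of_weilTypeCM
    (h : ∀ (B : AbelianVariety ℂ) (η : B ⟶ B) (R : Polynomial ℤ) (e₀ k : ℕ), 2 ≤ e₀ →
      IsWeilTypeCM B η R e₀ k → ∀ c ∈ weilClassesField B η (R.comp (X ^ 2)) (2 * k),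
        IsRationalClass c → IsOfHodgeType B.dim B.X (2 * k) k k c → c ∈ algebraicClasses B.X k)
    (A : AbelianVariety ℂ) (φ : A ⟶ A) (P : Polynomial ℤ) (e m : ℕ) (hPm : P.Monic)
    (hPe : P.natDegree = e) (he2 : 2 < e) (hPirr : Irreducible (P.map (Int.castRingHom ℚ)))
    (hφ : Polynomial.eval₂ (Int.castRingHom (CategoryTheory.End A)) (φ : CategoryTheory.End A) P = 0)
    (hdim : e * (2 * m) = 2 * A.dim)
    (hnr : ∀ ρ : ℂ, Polynomial.eval₂ (Int.castRingHom ℂ) ρ P = 0 → starRingEnd ℂ ρ ≠ ρ)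
    (hQ : ∃ Q : Polynomial ℚ, ∀ ρ : ℂ, Polynomial.eval₂ (Int.castRingHom ℂ) ρ P = 0 →
      Polynomial.eval₂ (algebraMap ℚ ℂ) ρ Q = starRingEnd ℂ ρ) :
    ∀ c ∈ weilClassesField A φ P (2 * m), IsRationalClass c →
      IsOfHodgeType A.dim A.X (2 * m) m m c → c ∈ algebraicClasses A.X m := by
  intro c hc hcQ hcH
  rcases Nat.eq_zero_or_pos m with hm0 | hm
  · subst hm0
    rw [algebraicClasses_zero]
    exact Submodule.mem_top
  by_cases hbal : ∀ ρ : ℂ, Polynomial.eval₂ (Int.castRingHom ℂ) ρ P = 0 →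
      eigenMultiplicity A φ ρ = eigenMultiplicity A φ (starRingEnd ℂ ρ)
  · obtain ⟨S, R, e₀, η, he, _, hWT, _, _, _, hW⟩ :=
      exists_isWeilTypeCM_of_cmField hPm hPe he2 hPirr hφ hdim hm hnr hQ hbal
    have hc' : c ∈ weilClassesField A η (R.comp (X ^ 2)) (2 * m) := by rw [hW]; exact hc
    exact h A η R e₀ m (by omega) hWT c hc' hcQ hcH
  · obtain ⟨ρ, hρ'⟩ := not_forall.1 hbal
    obtain ⟨hρ, hne⟩ := Classical.not_imp.1 hρ'
    have hcrit := (MoonenZarhin1998_weilClasses_hodgeCriterion_holds A φ P e (2 * m) hPm hPe hPirr hφ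
      hdim).2 ⟨ρ, hρ, hne⟩ c hc hcQ
    have h22 : 2 * m / 2 = m := by omega
    rw [h22] at hcrit
    rw [hcrit hcH]
    exact Submodule.zero_mem _

end Geometry

end Literature.AlgebraicGeometry.Deligne1982
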